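import Summits.HubbardSuperconductivity.HubbardSuperconductivity.Theses.CooperPairDMottWalk
import Summits.HubbardSuperconductivity.HubbardSuperconductivity.Theorems.CooperPairDMottWalkDiluteBECBridgeBirth
import Literature.MathematicalPhysics.QuantumLattice.PairFieldEvenSideLRO

/-!
# Crux `DiluteBECBridge` (stmt-HubbardSuperconductivity-10314) — birth skeleton `Lines/birth.lean` (BC3)

Route `CooperPairDMottWalk` (route-HubbardSuperconductivity-CooperPairDMottWalk; the crux is shared
verbatim with route `HyperoctahedralMott`) of `HubbardSuperconductivity/HubbardSuperconductivity`,
crux of rank 4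
(`Summit.HubbardSuperconductivity.HubbardSuperconductivity.Theses.CooperPairDMottWalk.DiluteBECBridge`):
for every `U ∈ [2, 8]`, an `L`-uniform pure-model Cooper pair of two doped holes
((a) pair binding `ε > 0`, (b) unique two-hole ground state, (c) macroscopic `d_{x²-y²}` pair
amplitude `z·L²`, on the tori of side `L = 4k + 4`) implies, at SOME hole doping `δ ∈ (0, 1/2)`,
`d_{x²-y²}` pair-field long-range order of EVERY sequence of normalised `(N_L, S^z = 0)`-sector
ground states of `hubbardTorus 2 L 1 U`, `N_L = 2⌊(1-δ)L²/2⌋`, along the even sides — the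
summit's body at fixed `(U, δ)`, verbatim.

## The line ("bound pairs stay bound when dilute, and a dilute gas of bound pairs condenses")

The crux's informal content is (R) a low-density reduction of the doped system to a dilute gas of
bound `d`-wave hole pairs and (B) Bose–Einstein condensation of that dilute gas. Both halves are
typed here over EXISTING declarations, in the currency the route already speaks (sector energies
`minEnergyOn (szSector N M)` and pair amplitudes between ground states of ADJACENT sectors —
clauses (a) and (c) of the Cooper pair are exactly the one-pair instances of the two stubs):

* `stub_pairGapPersists` (R — PAIRS STAY BOUND IN A DILUTE WINDOW): the two-hole binding
  energy of clause (a) persists, uniformly in `L`, as an odd–even (pairing) gap at finite small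
  hole density: for every `U ∈ [2,8]` with a pure Cooper pair there is `δ₀ ∈ (0, 1/2)` such that
  for every `δ ∈ (0, δ₀]`: `E_L(N_L - 2, 0) + E_L(N_L, 0) + ε' ≤ 2·E_L(N_L - 1, ½)` with `ε' > 0`,
  all large even `L` (`N_L = 2⌊(1-δ)L²/2⌋`, `E_L(N, M) = minEnergyOn (szSector N M)` of
  `hubbardTorus 2 L 1 U`). This is the BEC-side signature "all carriers paired, no gapless
  unpaired fermion" (pair chemical potential below the two-carrier continuum), i.e. the typed
  form of "at pair density `δ/2 ≪ 1/ξ_p²` the pairs do not overlap and do not unbind"; at one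
  pair (`N_L = L² - 2` for `δL² ≤ 2`) it is clause (a) itself. Free fermions violate it
  (`2E(N-1) - E(N) - E(N-2) ≤ 0` by level filling), so it is a genuine interaction effect.
  Why it might fail: a nodal `d`-wave (BCS-side) state at every `δ > 0` has odd–even gap
  `O(1/L)` (nodal quasiparticles), so (R) is false as typed if no BEC window exists at
  `δ → 0⁺` even when the summit holds; phase separation / stripes at the underdoped edge of the
  pure model [arXiv:1701.00054; QinEtAl2020 §IV]. Size L.
* `stub_dilutePairCondensation` (B — A DILUTE GAS OF BOUND PAIRS CONDENSES, volume-order form;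
  reshaped 2026-08-17 by lead c6 from the planner's Anderson-tower form): for every `U ∈ [2,8]`
  with a pure Cooper pair there is `δ₁ ∈ (0, 1/2)` such that for every `δ ∈ (0, δ₁]` at which
  the pairing gap of (R) holds, there are `c > 0` and `L₁` with: for all even `L ≥ L₁` and EVERY
  normalised ground state `ψ` of the sector `(N_L, 0)`, `c·L⁴ ≤ re ⟨ψ, Δ_d† Δ_d ψ⟩`
  (`Δ_d = pairField dWaveFormFactor L`). This is Penrose–Onsager / Yang off-diagonal long-range
  order of the pair condensate at volume order (`⟨Δ_d† Δ_d⟩ ≈ Z_d ρ₀ L⁴` with `n₀ = ρ₀L²`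
  condensed pairs and quasiparticle weight `Z_d`; clause (c) is its one-pair shadow
  `|⟨ψ₂, Δ_d ψ₀⟩|² ≥ zL²`) and is EXACTLY what the composition consumes. The planner's tower
  form (a normalised ground state `φ` of `(N_L - 2, 0)` with `c·L⁴ ≤ |⟨φ, Δ_d ψ⟩|²`) implies it
  (`birth_volumeOrder_of_towerForm`, Cauchy–Schwarz, LANDED) and is kept as the sufficient condition a
  Feshbach/pair-sector reduction would deliver; its extra failure modes (an `SU(2)` / momentum /
  `C₄` selection rule between the two ground multiplets, degeneracy of the `(N_L - 2, 0)` ground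
  space) are thereby removed from the line. It carries the crux's load: `T = 0` BEC of a dilute
  two-dimensional lattice Bose gas is open off the half-filled reflection-positivity point
  [KennedyLiebShastry1988; AizenmanEtAl2004; LiebSeiringerSolovejYngvason2005 Ch. 11] (barrier
  `Literature.Barriers.AtomisticToContinuum.HalfFillingReflectionPositivity`), and hole
  crystals / stripes with a pair charge gap are the physical enemy [arXiv:1701.00054;
  ArovasBergKivelsonRaghu2022 §8]. Size XL (summit-hard half of the crux).
* `diluteBECBridge_of_pairGap_of_condensation : R → B → DiluteBECBridge` — the composition,
  PROVED and LANDED (`Theorems/CooperPairDMottWalkDiluteBECBridgeBirth.lean`, p147085, lead c11):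
  given `U`, the Cooper-pair data feeds both stubs; `δ := min δ₀ δ₁ ∈ (0, 1/2)`; (R) at `δ`
  gives the pairing gap, (B) the volume-order bound; for a summit sequence `(N, ψ)` at `(U, δ)`
  and even side `n + 1 ≥ L₁`, the sum rule `re ⟨Δ_d† Δ_d⟩ = Σ_{x,y} G_L(x,y)`
  (`sum_pairFieldCorr_succ`) and the even-side bookkeeping `hasLongRangeOrder_even_of_le`
  (tree, sorry-free) give `HasLongRangeOrder` of the pull-back of
  `pairFieldCorr dWaveFormFactor ψ` over `halfOpenBox 2 (2k)` — the crux BY NAME.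
* `DiluteBECBridge_of_stubs : DiluteBECBridge` — the same, hypothesis-free, from the two named
  stubs (its only `sorry`s are inside `stub_*`).

Disproof used: none filed for this crux (`ledger crux ls stmt-HubbardSuperconductivity-10314`: no
workfiles at registration; no `Disproof.lean`). Negatives index (`ledger negatives --problem
HubbardSuperconductivity`, 2 entries: CooperPairDMottWalk breathing self-duality at `L = 2`,
AposterioriCapRg KLS order openness): neither concerns pairing gaps or pair amplitudes.
Evidence read: CruxAttack.md / CruxShape.lean (refuter, 2026-08-15: crux = `∀U∈[2,8], X(U) →
∃δ, SummitBody(U,δ)`, survives, summit-hard; content (R)+(B)), grounder note (B open in print).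
Sources: Scalapino1995 §2 (pair-field order), Yang1962 §4 (ODLRO), KennedyLiebShastry1988,
AizenmanEtAl2004, LiebSeiringerSolovejYngvason2005, arXiv:1701.00054, QinEtAl2020,
ArovasBergKivelsonRaghu2022, doi:10.1103/RevModPhys.66.763 (pair binding vs doping in clusters).
-/

-- `Summit.<Summit>.<Problem>`: for the single-conjunct summit the duplicate segment is mandated.
set_option linter.dupNamespace false

namespace Summit.HubbardSuperconductivity.HubbardSuperconductivity.Cruxes.DiluteBECBridge.Birth

open scoped Matrix ComplexOrder
open Literature.MathematicalPhysics.QuantumLattice Literature.Probability.LatticeModels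
open Summit.HubbardSuperconductivity.HubbardSuperconductivity.Theses.CooperPairDMottWalk

/-! ## The two registered stubs -/

/-- **Stub R — the pairing gap persists in a dilute window.** For every `U ∈ [2,8]`: if the pure
model has an `L`-uniform Cooper pair (clauses (a)(b)(c) on the sides `4k+4`, the crux's
hypothesis verbatim), then there is `δ₀ ∈ (0, 1/2)` such that for every hole doping
`δ ∈ (0, δ₀]` the odd–even gap at filling `N_L = 2⌊(1-δ)L²/2⌋` is uniform:
`E_L(N_L-2, 0) + E_L(N_L, 0) + ε' ≤ 2 E_L(N_L-1, ½)`, `ε' > 0`, for all large even `L`.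
Why plausibly true: binding is local; at pair density `≪ ξ_p⁻²` the pair chemical potential sits
`≈ ε/2` below the two-carrier continuum (BEC side, fully gapped even for `d`-wave symmetry).
Why it might fail: nodal BCS-side state at every `δ > 0` (gap `O(1/L)`); stripes / phase
separation at the underdoped edge. [cite: doi:10.1103/RevModPhys.66.763]
[cite: arXiv:1701.00054] [cite: QinEtAl2020, §IV] -/
theorem stub_pairGapPersists :
    let CP := fun (L : ℕ) [NeZero L]
        (H : Matrix (Finset (Orb (FermionTorus 2 L))) (Finset (Orb (FermionTorus 2 L))) ℂ)
        (ε z : ℝ) =>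
      H.minEnergyOn (szSector (L ^ 2 - 2) 0) + H.minEnergyOn (szSector (L ^ 2) 0) + ε ≤
          2 * H.minEnergyOn (szSector (L ^ 2 - 1) (1 / 2)) ∧
        (∀ φ₁ φ₂, IsGroundStateInSector H (L ^ 2 - 2) 0 φ₁ →
          IsGroundStateInSector H (L ^ 2 - 2) 0 φ₂ → ∃ c : ℂ, φ₂ = c • φ₁) ∧
        (∀ φ₀ φ₂, IsGroundStateInSector H (L ^ 2) 0 φ₀ →
          IsGroundStateInSector H (L ^ 2 - 2) 0 φ₂ →
            z * (L : ℝ) ^ 2 * (star φ₀ ⬝ᵥ φ₀).re * (star φ₂ ⬝ᵥ φ₂).re ≤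
              ‖star φ₂ ⬝ᵥ (pairField dWaveFormFactor L *ᵥ φ₀)‖ ^ 2);
    let PG := fun (U δ : ℝ) =>
      ∃ ε' > (0 : ℝ), ∃ L₁ : ℕ, ∀ L : ℕ, L₁ ≤ L → Even L →
        (hubbardTorus 2 L 1 U).minEnergyOn (szSector (2 * ⌊(1 - δ) * (L : ℝ) ^ 2 / 2⌋₊ - 2) 0) +
              (hubbardTorus 2 L 1 U).minEnergyOn (szSector (2 * ⌊(1 - δ) * (L : ℝ) ^ 2 / 2⌋₊) 0) +
            ε' ≤
          2 * (hubbardTorus 2 L 1 U).minEnergyOn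
            (szSector (2 * ⌊(1 - δ) * (L : ℝ) ^ 2 / 2⌋₊ - 1) (1 / 2));
    ∀ U ∈ Set.Icc (2 : ℝ) 8,
      (∃ ε > (0 : ℝ), ∃ z > (0 : ℝ), ∃ k₀ : ℕ, ∀ k ≥ k₀,
          CP (4 * k + 4) (hubbardTorus 2 (4 * k + 4) 1 U) ε z) →
        ∃ δ₀ ∈ Set.Ioo (0 : ℝ) (1 / 2), ∀ δ ∈ Set.Ioc (0 : ℝ) δ₀, PG U δ := by
  sorry

/-- **Stub B — a dilute gas of bound pairs condenses (volume-order pair-field form; reshaped by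
lead c6 from the planner's Anderson-tower form, which implies it: `birth_volumeOrder_of_towerForm`,
landed in `Theorems/CooperPairDMottWalkDiluteBECBridgeBirth.lean`).**
For every `U ∈ [2,8]`: if the pure model has an `L`-uniform Cooper pair (the crux's hypothesis
verbatim), then there is `δ₁ ∈ (0, 1/2)` such that for every `δ ∈ (0, δ₁]` AT WHICH THE PAIRING
GAP OF STUB R HOLDS there are `c > 0`, `L₁` with: for every even `L ≥ L₁` and every normalised
ground state `ψ` of the sector `(N_L, S^z = 0)` of `hubbardTorus 2 L 1 U`, `N_L = 2⌊(1-δ)L²/2⌋`,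
`c · L⁴ ≤ re ⟨ψ, Δ_d† Δ_d ψ⟩`, `Δ_d = pairField dWaveFormFactor L` — macroscopic occupation
`⟨Δ_d† Δ_d⟩ ≈ Z_d ρ₀ L⁴` of the zero-momentum `d`-pair mode (Penrose–Onsager / Yang ODLRO of the
pair condensate at volume order; clause (c) of the Cooper pair is its one-pair shadow `Z_d · L²`).
This is EXACTLY what the composition consumes (weakest form closing the crux through
`sum_pairFieldCorr_succ` + `hasLongRangeOrder_even_of_le`); the tower form (a normalised ground
state `φ` of `(N_L - 2, 0)` with `c·L⁴ ≤ |⟨φ, Δ_d ψ⟩|²`) implies it by Cauchy–Schwarz and carries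
extra selection-rule failure modes (total spin / momentum / `C₄` character of the two ground
multiplets, degeneracy of the `(N_L - 2, 0)` ground space) that are no part of the crux.
Why plausibly true: a dilute Bose gas of bound pairs with short-range repulsion condenses at
`T = 0` (Schick; Lieb–Yngvason energetics), and clause (c) makes the condensate visible in the
nearest-neighbour `d`-wave channel. Why it might fail: `T = 0` BEC of dilute 2D lattice bosons is
OPEN off half filling (reflection positivity needs the particle–hole point); hole crystals /
stripes with a pair charge gap as `δ → 0⁺`.
[cite: Yang1962, §4] [cite: KennedyLiebShastry1988] [cite: AizenmanEtAl2004]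
[cite: LiebSeiringerSolovejYngvason2005, Ch. 11] [cite: arXiv:1701.00054]
[cite: ArovasBergKivelsonRaghu2022, §8] -/
theorem stub_dilutePairCondensation :
    let CP := fun (L : ℕ) [NeZero L]
        (H : Matrix (Finset (Orb (FermionTorus 2 L))) (Finset (Orb (FermionTorus 2 L))) ℂ)
        (ε z : ℝ) =>
      H.minEnergyOn (szSector (L ^ 2 - 2) 0) + H.minEnergyOn (szSector (L ^ 2) 0) + ε ≤
          2 * H.minEnergyOn (szSector (L ^ 2 - 1) (1 / 2)) ∧
        (∀ φ₁ φ₂, IsGroundStateInSector H (L ^ 2 - 2) 0 φ₁ →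
          IsGroundStateInSector H (L ^ 2 - 2) 0 φ₂ → ∃ c : ℂ, φ₂ = c • φ₁) ∧
        (∀ φ₀ φ₂, IsGroundStateInSector H (L ^ 2) 0 φ₀ →
          IsGroundStateInSector H (L ^ 2 - 2) 0 φ₂ →
            z * (L : ℝ) ^ 2 * (star φ₀ ⬝ᵥ φ₀).re * (star φ₂ ⬝ᵥ φ₂).re ≤
              ‖star φ₂ ⬝ᵥ (pairField dWaveFormFactor L *ᵥ φ₀)‖ ^ 2);
    let PG := fun (U δ : ℝ) =>
      ∃ ε' > (0 : ℝ), ∃ L₁ : ℕ, ∀ L : ℕ, L₁ ≤ L → Even L →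
        (hubbardTorus 2 L 1 U).minEnergyOn (szSector (2 * ⌊(1 - δ) * (L : ℝ) ^ 2 / 2⌋₊ - 2) 0) +
              (hubbardTorus 2 L 1 U).minEnergyOn (szSector (2 * ⌊(1 - δ) * (L : ℝ) ^ 2 / 2⌋₊) 0) +
            ε' ≤
          2 * (hubbardTorus 2 L 1 U).minEnergyOn
            (szSector (2 * ⌊(1 - δ) * (L : ℝ) ^ 2 / 2⌋₊ - 1) (1 / 2));
    let VO := fun (U δ : ℝ) =>
      ∃ c > (0 : ℝ), ∃ L₁ : ℕ, ∀ (L : ℕ) [NeZero L], L₁ ≤ L → Even L →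
        ∀ ψ : Fock (Orb (FermionTorus 2 L)), star ψ ⬝ᵥ ψ = 1 →
          IsGroundStateInSector (hubbardTorus 2 L 1 U) (2 * ⌊(1 - δ) * (L : ℝ) ^ 2 / 2⌋₊) 0 ψ →
            c * (L : ℝ) ^ 4 ≤
              (expect ((pairField dWaveFormFactor L)ᴴ * pairField dWaveFormFactor L) ψ).re;
    ∀ U ∈ Set.Icc (2 : ℝ) 8,
      (∃ ε > (0 : ℝ), ∃ z > (0 : ℝ), ∃ k₀ : ℕ, ∀ k ≥ k₀,
          CP (4 * k + 4) (hubbardTorus 2 (4 * k + 4) 1 U) ε z) →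
        ∃ δ₁ ∈ Set.Ioo (0 : ℝ) (1 / 2), ∀ δ ∈ Set.Ioc (0 : ℝ) δ₁, PG U δ → VO U δ := by
  sorry

/-! ## The composition (LANDED through the gate: `Theorems/CooperPairDMottWalkDiluteBECBridgeBirth.lean`, p147085, 2026-08-17) -/

/-- **The crux BY NAME from the two named stubs**, through the landed composition
`Theorems.CooperPairDMottWalk.diluteBECBridge_of_pairGap_of_condensation : R → B → DiluteBECBridge`
(`δ := min δ₀ δ₁`; R at `δ` gives the pairing gap, B the volume-order floor
`c L⁴ ≤ re ⟨ψ, Δ_d† Δ_d ψ⟩`; `sum_pairFieldCorr_succ` + `hasLongRangeOrder_even_of_le` give the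
summit-format even-side long-range order). Its only `sorry`s are the two `stub_*`, once each. The
Cauchy–Schwarz lemma and the tower-form ⇒ volume-order reduction of stub B also live in that
Theorems file (`birth_norm_sq_star_dotProduct_mulVec_le`, `birth_volumeOrder_of_towerForm`). -/
theorem DiluteBECBridge_of_stubs : DiluteBECBridge :=
  Summit.HubbardSuperconductivity.HubbardSuperconductivity.Theorems.CooperPairDMottWalk.diluteBECBridge_of_pairGap_of_condensation
    stub_pairGapPersists stub_dilutePairCondensation

end Summit.HubbardSuperconductivity.HubbardSuperconductivity.Cruxes.DiluteBECBridge.Birth
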